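import Literature.AlgebraicGeometry.Motives.AtypicalHodgeLocus
import Literature.AlgebraicGeometry.Motives.GeometricVHSPolarizedTransport
import HarnessLib

/-!
# The Mumford–Tate rank is an invariant of the isomorphism class of a Hodge structure

Family `hodge`, layer `Literature/AlgebraicGeometry/Motives` (fact seat of
`HodgeTheory.bku_finite_monodromyOrbit_of_isHodgeGenericIn`). That named fact, and the route
`PeriodDeficiency` (cruxes `QbarGenericIsHodgeGeneric`, `DeficiencyBound`), phrase Hodge-genericity of
a point `s` of the base of a family through a geometric VHS datum `D` (`VHSData.IsHodgeGenericIn`,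
`VHSData.mtRankAt s = (D.hodge s).mtRank`, the dimension of the Mumford–Tate Lie algebra
`HodgeStructure.mumfordTateLieAlgebra` — Deligne, LNM 900, I §3; Baldi–Klingler–Ullmo §3.2), whose
fibrewise Hodge structure `D.hodge s` is the Hodge structure `B.hodge` of the fibre `𝒳_s` TRANSPORTED
along the identification `D.fiberIso s : V_s ≃ Hⁱ(𝒳_s)` (`GeometricVHSData.hodge_eq_comapEquiv`).
This file PROVES that the Mumford–Tate rank does not see the transport, so that Hodge-genericity is a
condition on the Hodge structures of the fibres alone (and in particular the same for all data `D`
of a given family):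

* `HodgeStructure.mtRank_comapEquiv` — **`dim MT(e^* H) = dim MT(H)`** for a Hodge structure `H` on
  `W` and a `ℚ`-linear equivalence `e : V ≃ W`; more precisely
  `HodgeStructure.mumfordTateLieAlgebra_comapEquiv`: **`𝔪𝔱(e^* H) = e⁻¹ 𝔪𝔱(H) e`**.
* `GeometricVHSData.mtRankAt_eq_mtRank_hodge`, `GeometricVHSData.isHodgeGenericIn_iff`,
  `GeometricVHSData.isHodgeGenericIn_iff_of_geometricVHSData` — the consequences just described.

The proof is transport of structure through Deligne's tensor constructions (Hodge II, 1.1.6–1.1.12)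
as the tree defines them (`HodgeTensor.lean`: explicit filtrations on `ℂ ⊗ V^∨`, `ℂ ⊗ (V ⊗ W)`,
`ℂ ⊗ V^{⊗r}` pulled back along the comparison maps `dualBaseChange`, `tensorBaseChange`,
`piTensorBaseChange`): the comparison maps are natural in linear maps
(`dualBaseChange_symm_dualMap_baseChange`, `tensorBaseChange_congr_baseChange`,
`piTensorBaseChange_map_baseChange`); ranges of `mapIncl` of pulled-back submodules are pulled-back
ranges (`TensorProduct.range_mapIncl_map_map`, `PiTensorProduct.range_mapIncl_map`,
`range_mapIncl_comap_baseChange`, `range_piMapIncl_comap_baseChange`); hence the dual, tensor and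
tensor-power filtrations, and so the Hodge structures `H^∨`, `H₁ ⊗ H₂`, `H^{⊗r}`, `T^{a,b} H`, of
transported structures are the transported ones (`dualFiltration_comapEquiv`, …,
`HodgeStructure.dual_comapEquiv`, `tensor_comapEquiv`, `tensorPower_comapEquiv`,
`tensorSpace_comapEquiv`, along `e⁻ᵀ`, `e₁ ⊗ e₂`, `e^{⊗r}`, `T^{a,b} e = e^{⊗a} ⊗ (e⁻ᵀ)^{⊗b}`); the
Leibniz action of `𝔤𝔩(V)` on `T^{a,b} V` is equivariant (`map_tensorPowerDeriv`,
`tensorSpaceCongr_tensorSpaceDeriv`: `T e (X · t) = (e X e⁻¹) · T e t`); and the Hodge tensors of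
`e^* H` are the `(T e)⁻¹`-images of those of `H` (`comapEquiv_hodgeClasses`). Everything is a
theorem; no definition and no named fact is introduced.

## References

* [Deligne1982HodgeCycles] P. Deligne, Hodge cycles on abelian varieties, in LNM 900 (1982), I §3
  (Prop. 3.1, 3.4: the Mumford–Tate group as the stabiliser of the Hodge tensors).
* [DeligneHodgeII1971] P. Deligne, Théorie de Hodge II, Publ. Math. IHÉS 40 (1971), 1.1.6–1.1.12,
  2.1 (duals, tensor products of Hodge structures).
* [BaldiKlinglerUllmo2024] G. Baldi, B. Klingler, E. Ullmo, On the distribution of the Hodge locus,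
  Invent. Math. 235 (2024), §3.1–3.2 (Hodge-generic points: `MT(𝕍_s)` of maximal dimension).
-/

noncomputable section

open scoped TensorProduct

universe u

namespace Literature.AlgebraicGeometry.Motives

variable {V W : Type u} [AddCommGroup V] [Module ℚ V] [AddCommGroup W] [Module ℚ W]

/-! ### Ranges of `mapIncl` of mapped submodules -/

section Ranges

variable {R : Type*} [CommRing R] {M M' N N' : Type*} [AddCommGroup M] [Module R M]
  [AddCommGroup M'] [Module R M'] [AddCommGroup N] [Module R N] [AddCommGroup N'] [Module R N']

/-- `range (p.map f ⊗ q.map g ↪ M' ⊗ N') = (map f g) (range (p ⊗ q ↪ M ⊗ N))`. [folklore] -/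
theorem TensorProduct.range_mapIncl_map_map (f : M →ₗ[R] M') (g : N →ₗ[R] N')
    (p : Submodule R M) (q : Submodule R N) :
    LinearMap.range (TensorProduct.mapIncl (p.map f) (q.map g)) =
      (LinearMap.range (TensorProduct.mapIncl p q)).map (TensorProduct.map f g) := by
  rw [TensorProduct.mapIncl, TensorProduct.range_map_eq_span_tmul, TensorProduct.mapIncl,
    TensorProduct.range_map_eq_span_tmul, Submodule.map_span]
  congr 1
  ext t
  simp only [Set.mem_setOf_eq, Submodule.coe_subtype, Set.mem_image]
  constructor
  · rintro ⟨⟨_, m, hm, rfl⟩, ⟨_, k, hk, rfl⟩, rfl⟩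
    exact ⟨_, ⟨⟨m, hm⟩, ⟨k, hk⟩, rfl⟩, TensorProduct.map_tmul f g m k⟩
  · rintro ⟨_, ⟨m, k, rfl⟩, rfl⟩
    exact ⟨⟨f m, Submodule.mem_map_of_mem m.2⟩, ⟨g k, Submodule.mem_map_of_mem k.2⟩,
      (TensorProduct.map_tmul f g m k).symm⟩

/-- `range (⨂ᵢ (pᵢ.map g) ↪ ⨂ᵢ M') = (⨂ g) (range (⨂ᵢ pᵢ ↪ ⨂ᵢ M))`. [folklore] -/
theorem PiTensorProduct.range_mapIncl_map {ι : Type*} [Fintype ι] [DecidableEq ι] (g : M →ₗ[R] M')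
    (p : ι → Submodule R M) :
    LinearMap.range (PiTensorProduct.mapIncl fun i ↦ (p i).map g) =
      (LinearMap.range (PiTensorProduct.mapIncl p)).map (PiTensorProduct.map fun _ ↦ g) := by
  rw [PiTensorProduct.mapIncl, PiTensorProduct.map_range_eq_span_tprod, PiTensorProduct.mapIncl,
    PiTensorProduct.map_range_eq_span_tprod, Submodule.map_span]
  congr 1
  ext t
  simp only [Set.mem_setOf_eq, Submodule.coe_subtype, Set.mem_image]
  constructor
  · rintro ⟨x, rfl⟩
    have hx : ∀ i, ∃ y ∈ p i, g y = x i := fun i ↦ Submodule.mem_map.1 (x i).2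
    choose y hy hyx using hx
    refine ⟨_, ⟨fun i ↦ ⟨y i, hy i⟩, rfl⟩, ?_⟩
    rw [PiTensorProduct.map_tprod]
    exact congrArg _ (funext hyx)
  · rintro ⟨_, ⟨y, rfl⟩, rfl⟩
    exact ⟨fun i ↦ ⟨g (y i), Submodule.mem_map_of_mem (y i).2⟩, (PiTensorProduct.map_tprod _ _).symm⟩

/-- Preimages along a linear equivalence commute with suprema. [folklore] -/
theorem Submodule.comap_equiv_iSup {ι : Sort*} (e : M ≃ₗ[R] M') (N : ι → Submodule R M') :
    (⨆ i, N i).comap (e : M →ₗ[R] M') = ⨆ i, (N i).comap (e : M →ₗ[R] M') := by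
  simp only [Submodule.comap_equiv_eq_map_symm, Submodule.map_iSup]

end Ranges

/-! ### Naturality of the base-change comparison maps -/

namespace HodgeStructure

/-- `dualBaseChange` is natural: `⟨(e⁻ᵀ)_ℂ ξ, y⟩ = ⟨ξ, e⁻¹_ℂ y⟩`. [folklore] -/
theorem dualBaseChange_symm_dualMap_baseChange (e : V ≃ₗ[ℚ] W) (ξ : ℂ ⊗[ℚ] Module.Dual ℚ V)
    (y : ℂ ⊗[ℚ] W) :
    dualBaseChange W ((e.symm.dualMap : Module.Dual ℚ V →ₗ[ℚ] Module.Dual ℚ W).baseChange ℂ ξ) y =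
      dualBaseChange V ξ (e.symm.toLinearMap.baseChange ℂ y) := by
  induction ξ using TensorProduct.induction_on with
  | zero => simp
  | add ξ₁ ξ₂ h₁ h₂ => simp only [map_add, LinearMap.add_apply, h₁, h₂]
  | tmul c φ =>
    induction y using TensorProduct.induction_on with
    | zero => simp
    | add y₁ y₂ h₁ h₂ => simp only [map_add, h₁, h₂]
    | tmul d w =>
      simp [LinearMap.baseChange_tmul, dualBaseChange_tmul_tmul, LinearEquiv.dualMap_apply]

/-- `tensorBaseChange` is natural in linear equivalences. [folklore] -/
theorem tensorBaseChange_congr_baseChange {V' W' : Type u} [AddCommGroup V'] [Module ℚ V']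
    [AddCommGroup W'] [Module ℚ W'] (e₁ : V ≃ₗ[ℚ] W) (e₂ : V' ≃ₗ[ℚ] W') (x : ℂ ⊗[ℚ] (V ⊗[ℚ] V')) :
    tensorBaseChange W W' ((TensorProduct.congr e₁ e₂).toLinearMap.baseChange ℂ x) =
      TensorProduct.map (e₁.toLinearMap.baseChange ℂ) (e₂.toLinearMap.baseChange ℂ)
        (tensorBaseChange V V' x) := by
  induction x using TensorProduct.induction_on with
  | zero => simp
  | add x y hx hy => simp only [map_add, hx, hy]
  | tmul c z =>
    induction z using TensorProduct.induction_on with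
    | zero => simp
    | add x y hx hy => simp only [TensorProduct.tmul_add, map_add, hx, hy]
    | tmul v v' => simp [LinearMap.baseChange_tmul, tensorBaseChange_tmul]

/-- `piTensorBaseChange` is natural in linear maps. [folklore] -/
theorem piTensorBaseChange_map_baseChange {ι : Type} [Fintype ι] [DecidableEq ι] (f : V →ₗ[ℚ] W)
    (x : ℂ ⊗[ℚ] (⨂[ℚ] _ : ι, V)) :
    piTensorBaseChange W ι ((PiTensorProduct.map fun _ ↦ f).baseChange ℂ x) =
      PiTensorProduct.map (fun _ ↦ f.baseChange ℂ) (piTensorBaseChange V ι x) := by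
  induction x using TensorProduct.induction_on with
  | zero => simp
  | add x y hx hy => simp only [map_add, hx, hy]
  | tmul c z =>
    induction z using PiTensorProduct.induction_on with
    | smul_tprod r v =>
      simp [LinearMap.baseChange_tmul, piTensorBaseChange_tmul_tprod, TensorProduct.tmul_smul,
        PiTensorProduct.map_tprod, ofRat_apply, LinearMap.baseChange_tmul]
    | add x y hx hy => simp only [TensorProduct.tmul_add, map_add, hx, hy]

/-! ### The dual, tensor and tensor-power filtrations of a transported Hodge structure -/

variable {n m : ℤ}

/-- Preimages along the complexification of a linear equivalence commute with suprema. [folklore] -/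
theorem comap_baseChange_iSup {X Y : Type*} [AddCommGroup X] [Module ℚ X] [AddCommGroup Y] [Module ℚ Y]
    {ι : Sort*} (g : X ≃ₗ[ℚ] Y) (N : ι → Submodule ℂ (ℂ ⊗[ℚ] Y)) :
    (⨆ i, N i).comap (g.toLinearMap.baseChange ℂ) = ⨆ i, (N i).comap (g.toLinearMap.baseChange ℂ) := by
  rw [← LinearEquiv.coe_baseChange, Submodule.comap_equiv_iSup]

/-- The dual filtration of `H.comapEquiv e` is the dual filtration of `H` pulled back along
`(e⁻ᵀ)_ℂ : (V^∨)_ℂ → (W^∨)_ℂ`. [folklore] -/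
theorem dualFiltration_comapEquiv (H : HodgeStructure W n) (e : V ≃ₗ[ℚ] W) (p : ℤ) :
    (H.comapEquiv e).dualFiltration p = (H.dualFiltration p).comap
      ((e.symm.dualMap : Module.Dual ℚ V →ₗ[ℚ] Module.Dual ℚ W).baseChange ℂ) := by
  ext ξ
  simp only [mem_dualFiltration_iff, comapEquiv_F, Submodule.mem_comap,
    dualBaseChange_symm_dualMap_baseChange]
  constructor
  · intro h y hy
    refine h _ ?_
    rwa [baseChange_apply_symm_baseChange]
  · intro h x hx
    simpa only [symm_baseChange_apply_baseChange] using h _ hx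

/-- Ranges of `mapIncl` of two pulled-back submodules (along complexified linear equivalences) are
the pulled-back range. [folklore] -/
theorem range_mapIncl_comap_baseChange {V' W' : Type u} [AddCommGroup V'] [Module ℚ V']
    [AddCommGroup W'] [Module ℚ W'] (e₁ : V ≃ₗ[ℚ] W) (e₂ : V' ≃ₗ[ℚ] W')
    (N₁ : Submodule ℂ (ℂ ⊗[ℚ] W)) (N₂ : Submodule ℂ (ℂ ⊗[ℚ] W')) :
    LinearMap.range (TensorProduct.mapIncl (N₁.comap (e₁.toLinearMap.baseChange ℂ))
      (N₂.comap (e₂.toLinearMap.baseChange ℂ))) =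
      (LinearMap.range (TensorProduct.mapIncl N₁ N₂)).comap
        (TensorProduct.map (e₁.toLinearMap.baseChange ℂ) (e₂.toLinearMap.baseChange ℂ)) := by
  have h₁ : N₁.comap (e₁.toLinearMap.baseChange ℂ) =
      N₁.map ((e₁.baseChange ℚ ℂ V W).symm : _ →ₗ[ℂ] _) := by
    rw [← LinearEquiv.coe_baseChange, Submodule.comap_equiv_eq_map_symm]
  have h₂ : N₂.comap (e₂.toLinearMap.baseChange ℂ) =
      N₂.map ((e₂.baseChange ℚ ℂ V' W').symm : _ →ₗ[ℂ] _) := by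
    rw [← LinearEquiv.coe_baseChange, Submodule.comap_equiv_eq_map_symm]
  have h : TensorProduct.map (e₁.toLinearMap.baseChange ℂ) (e₂.toLinearMap.baseChange ℂ) =
      ((TensorProduct.congr (e₁.baseChange ℚ ℂ V W) (e₂.baseChange ℚ ℂ V' W')) : _ →ₗ[ℂ] _) := rfl
  rw [h₁, h₂, TensorProduct.range_mapIncl_map_map, h, Submodule.comap_equiv_eq_map_symm]
  rfl

/-- Ranges of `mapIncl` of a family of pulled-back submodules (along a complexified linear
equivalence) are the pulled-back range. [folklore] -/
theorem range_piMapIncl_comap_baseChange {r : ℕ} (e : V ≃ₗ[ℚ] W)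
    (N : Fin r → Submodule ℂ (ℂ ⊗[ℚ] W)) :
    LinearMap.range (PiTensorProduct.mapIncl fun i ↦ (N i).comap (e.toLinearMap.baseChange ℂ)) =
      (LinearMap.range (PiTensorProduct.mapIncl N)).comap
        (PiTensorProduct.map fun _ : Fin r ↦ e.toLinearMap.baseChange ℂ) := by
  rw [PiTensorProduct.mapIncl, PiTensorProduct.map_range_eq_span_tprod, PiTensorProduct.mapIncl,
    PiTensorProduct.map_range_eq_span_tprod]
  apply le_antisymm
  · refine Submodule.span_le.2 ?_
    rintro _ ⟨x, rfl⟩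
    refine Submodule.mem_comap.2 ?_
    rw [PiTensorProduct.map_tprod]
    exact Submodule.subset_span ⟨fun i ↦ ⟨_, (x i).2⟩, rfl⟩
  · intro t ht
    rw [Submodule.mem_comap] at ht
    -- write `t = (e^{⊗r})_ℂ⁻¹ ((e^{⊗r})_ℂ t)` and use that the inverse maps generators to generators
    have hinv : t = (PiTensorProduct.map fun _ : Fin r ↦ e.symm.toLinearMap.baseChange ℂ)
        ((PiTensorProduct.map fun _ : Fin r ↦ e.toLinearMap.baseChange ℂ) t) := by
      rw [← LinearMap.comp_apply, ← PiTensorProduct.map_comp]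
      conv_lhs => rw [← LinearMap.id_apply (R := ℂ) t, ← PiTensorProduct.map_id]
      congr 2
      funext i
      exact (LinearMap.ext fun x ↦ symm_baseChange_apply_baseChange e x).symm
    rw [hinv]
    refine Submodule.span_induction (hx := ht) (p := fun y _ ↦
      (PiTensorProduct.map fun _ : Fin r ↦ e.symm.toLinearMap.baseChange ℂ) y ∈ _) ?_ ?_ ?_ ?_
    · rintro _ ⟨x, rfl⟩
      rw [PiTensorProduct.map_tprod]
      refine Submodule.subset_span ⟨fun i ↦ ⟨e.symm.toLinearMap.baseChange ℂ (x i), ?_⟩, rfl⟩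
      change e.toLinearMap.baseChange ℂ (e.symm.toLinearMap.baseChange ℂ (x i)) ∈ N i
      rw [baseChange_apply_symm_baseChange]
      exact (x i).2
    · simp
    · intro x y _ _ hx hy
      simpa only [map_add] using Submodule.add_mem _ hx hy
    · intro c x _ hx
      simpa only [map_smul] using Submodule.smul_mem _ c hx

/-- `range_mapIncl_comap_baseChange` for the filtrations of transported Hodge structures (stated
with `(H.comapEquiv e).F`, so that it rewrites under the binders of `tensorFiltration`). [folklore] -/
theorem range_mapIncl_comapEquiv_F {V' W' : Type u} [AddCommGroup V'] [Module ℚ V']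
    [AddCommGroup W'] [Module ℚ W'] (H₁ : HodgeStructure W n) (H₂ : HodgeStructure W' m)
    (e₁ : V ≃ₗ[ℚ] W) (e₂ : V' ≃ₗ[ℚ] W') (a b : ℤ) :
    LinearMap.range (TensorProduct.mapIncl ((H₁.comapEquiv e₁).F a) ((H₂.comapEquiv e₂).F b)) =
      (LinearMap.range (TensorProduct.mapIncl (H₁.F a) (H₂.F b))).comap
        (TensorProduct.map (e₁.toLinearMap.baseChange ℂ) (e₂.toLinearMap.baseChange ℂ)) :=
  range_mapIncl_comap_baseChange e₁ e₂ (H₁.F a) (H₂.F b)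

/-- `range_piMapIncl_comap_baseChange` for the filtration of a transported Hodge structure.
[folklore] -/
theorem range_piMapIncl_comapEquiv_F {r : ℕ} (H : HodgeStructure W n) (e : V ≃ₗ[ℚ] W)
    (a : Fin r → ℤ) :
    LinearMap.range (PiTensorProduct.mapIncl fun i ↦ (H.comapEquiv e).F (a i)) =
      (LinearMap.range (PiTensorProduct.mapIncl fun i ↦ H.F (a i))).comap
        (PiTensorProduct.map fun _ : Fin r ↦ e.toLinearMap.baseChange ℂ) :=
  range_piMapIncl_comap_baseChange e fun i ↦ H.F (a i)

/-- The tensor filtration of two transported structures is the tensor filtration pulled back along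
`(e₁ ⊗ e₂)_ℂ`. [folklore] -/
theorem tensorFiltration_comapEquiv {V' W' : Type u} [AddCommGroup V'] [Module ℚ V']
    [AddCommGroup W'] [Module ℚ W'] (H₁ : HodgeStructure W n) (H₂ : HodgeStructure W' m)
    (e₁ : V ≃ₗ[ℚ] W) (e₂ : V' ≃ₗ[ℚ] W') (p : ℤ) :
    (H₁.comapEquiv e₁).tensorFiltration (H₂.comapEquiv e₂) p =
      (H₁.tensorFiltration H₂ p).comap ((TensorProduct.congr e₁ e₂).toLinearMap.baseChange ℂ) := by
  have hnat : (tensorBaseChange W W' : ℂ ⊗[ℚ] (W ⊗[ℚ] W') →ₗ[ℂ] _) ∘ₗ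
      ((TensorProduct.congr e₁ e₂).toLinearMap.baseChange ℂ) =
      (TensorProduct.map (e₁.toLinearMap.baseChange ℂ) (e₂.toLinearMap.baseChange ℂ)) ∘ₗ
        (tensorBaseChange V V' : ℂ ⊗[ℚ] (V ⊗[ℚ] V') →ₗ[ℂ] _) := by
    apply LinearMap.ext
    intro x
    exact tensorBaseChange_congr_baseChange e₁ e₂ x
  simp only [tensorFiltration]
  rw [comap_baseChange_iSup]
  refine iSup_congr fun a ↦ ?_
  rw [comap_baseChange_iSup]
  refine iSup_congr fun b ↦ ?_
  rw [comap_baseChange_iSup]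
  refine iSup_congr fun _ ↦ ?_
  rw [range_mapIncl_comapEquiv_F, ← Submodule.comap_comp, ← Submodule.comap_comp, hnat]

/-- The tensor-power filtration of a transported structure is the tensor-power filtration pulled
back along `(e^{⊗r})_ℂ`. [folklore] -/
theorem tensorPowerFiltration_comapEquiv (H : HodgeStructure W n) (e : V ≃ₗ[ℚ] W) (r : ℕ) (p : ℤ) :
    (H.comapEquiv e).tensorPowerFiltration r p =
      (H.tensorPowerFiltration r p).comap
        ((PiTensorProduct.congr fun _ : Fin r ↦ e).toLinearMap.baseChange ℂ) := by
  have hnat : (piTensorBaseChange W (Fin r)) ∘ₗ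
      ((PiTensorProduct.congr fun _ : Fin r ↦ e).toLinearMap.baseChange ℂ) =
      (PiTensorProduct.map fun _ : Fin r ↦ e.toLinearMap.baseChange ℂ) ∘ₗ
        piTensorBaseChange V (Fin r) := by
    apply LinearMap.ext
    intro x
    exact piTensorBaseChange_map_baseChange (e : V →ₗ[ℚ] W) x
  simp only [tensorPowerFiltration]
  rw [comap_baseChange_iSup]
  refine iSup_congr fun a ↦ ?_
  rw [comap_baseChange_iSup]
  refine iSup_congr fun _ ↦ ?_
  rw [range_piMapIncl_comapEquiv_F, ← Submodule.comap_comp, ← Submodule.comap_comp, hnat]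

/-! ### Duals, tensor products, tensor powers and tensor spaces of a transported Hodge structure -/

/-- `cast` commutes with transport. [folklore] -/
theorem cast_comapEquiv (H : HodgeStructure W n) (e : V ≃ₗ[ℚ] W) (h : n = m) :
    (H.comapEquiv e).cast h = (H.cast h).comapEquiv e := rfl

variable [HodgeTensorFacts.{u, u}]

/-- **The dual of a transported Hodge structure**: `(e^* H)^∨ = (e⁻ᵀ)^* (H^∨)`. [folklore] -/
theorem dual_comapEquiv [Module.Finite ℚ V] [Module.Finite ℚ W] (H : HodgeStructure W n)
    (e : V ≃ₗ[ℚ] W) : (H.comapEquiv e).dual = H.dual.comapEquiv e.symm.dualMap :=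
  HodgeStructure.ext (funext fun p ↦ dualFiltration_comapEquiv H e p)

/-- **The tensor product of transported Hodge structures**: `e₁^* H₁ ⊗ e₂^* H₂ = (e₁ ⊗ e₂)^* (H₁ ⊗ H₂)`.
[folklore] -/
theorem tensor_comapEquiv {V' W' : Type u} [AddCommGroup V'] [Module ℚ V']
    [AddCommGroup W'] [Module ℚ W'] (H₁ : HodgeStructure W n) (H₂ : HodgeStructure W' m)
    (e₁ : V ≃ₗ[ℚ] W) (e₂ : V' ≃ₗ[ℚ] W') :
    (H₁.comapEquiv e₁).tensor (H₂.comapEquiv e₂) =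
      (H₁.tensor H₂).comapEquiv (TensorProduct.congr e₁ e₂) :=
  HodgeStructure.ext (funext fun p ↦ tensorFiltration_comapEquiv H₁ H₂ e₁ e₂ p)

/-- **Tensor powers of a transported Hodge structure**: `(e^* H)^{⊗r} = (e^{⊗r})^* (H^{⊗r})`.
[folklore] -/
theorem tensorPower_comapEquiv (H : HodgeStructure W n) (e : V ≃ₗ[ℚ] W) (r : ℕ) :
    (H.comapEquiv e).tensorPower r =
      (H.tensorPower r).comapEquiv (PiTensorProduct.congr fun _ : Fin r ↦ e) :=
  HodgeStructure.ext (funext fun p ↦ tensorPowerFiltration_comapEquiv H e r p)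

/-- **Tensor spaces of a transported Hodge structure**: `T^{a,b}(e^* H) = (T^{a,b} e)^* (T^{a,b} H)`
with `T^{a,b} e = e^{⊗a} ⊗ (e⁻ᵀ)^{⊗b}`. [folklore] -/
theorem tensorSpace_comapEquiv [Module.Finite ℚ V] [Module.Finite ℚ W] (H : HodgeStructure W n)
    (e : V ≃ₗ[ℚ] W) (a b : ℕ) :
    (H.comapEquiv e).tensorSpace a b = (H.tensorSpace a b).comapEquiv
      (TensorProduct.congr (PiTensorProduct.congr fun _ : Fin a ↦ e)
        (PiTensorProduct.congr fun _ : Fin b ↦ e.symm.dualMap)) := by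
  rw [HodgeStructure.tensorSpace, tensorPower_comapEquiv, dual_comapEquiv, tensorPower_comapEquiv,
    tensor_comapEquiv, cast_comapEquiv]
  rfl

/-! ### Equivariance of the derivation action -/

end HodgeStructure

/-- **Equivariance of the Leibniz action on tensor powers**: for a linear equivalence `g : V ≃ W`,
`g^{⊗r} (X · x) = (g X g⁻¹) · (g^{⊗r} x)`. [folklore] -/
theorem map_tensorPowerDeriv (g : V ≃ₗ[ℚ] W) (r : ℕ) (X : Module.End ℚ V) (x : ⨂[ℚ]^r V) :
    PiTensorProduct.map (fun _ : Fin r ↦ (g : V →ₗ[ℚ] W)) (tensorPowerDeriv V r X x) =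
      tensorPowerDeriv W r (g.conj X) (PiTensorProduct.map (fun _ : Fin r ↦ (g : V →ₗ[ℚ] W)) x) := by
  -- both sides are linear in `x`: check on pure tensors
  suffices h : (PiTensorProduct.map fun _ : Fin r ↦ (g : V →ₗ[ℚ] W)) ∘ₗ tensorPowerDeriv V r X =
      tensorPowerDeriv W r (g.conj X) ∘ₗ PiTensorProduct.map fun _ : Fin r ↦ (g : V →ₗ[ℚ] W) from
    LinearMap.congr_fun h x
  ext v
  simp only [LinearMap.compMultilinearMap_apply, LinearMap.coe_comp, Function.comp_apply,
    PiTensorProduct.map_tprod, tensorPowerDeriv_tprod, map_sum]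
  refine Finset.sum_congr rfl fun i _ ↦ ?_
  congr 1
  funext j
  by_cases hj : j = i
  · subst hj
    simp [Function.update_self, LinearEquiv.conj_apply]
  · simp [Function.update_of_ne hj]

/-- The contragredient of a conjugate: `(e⁻ᵀ) Xᵀ (e⁻ᵀ)⁻¹ = (e X e⁻¹)ᵀ` on `W^∨`. [folklore] -/
theorem conj_symm_dualMap_dualMap (e : V ≃ₗ[ℚ] W) (X : Module.End ℚ V) :
    e.symm.dualMap.conj X.dualMap = (e.conj X).dualMap := by
  ext ψ w
  simp [LinearEquiv.conj_apply, LinearEquiv.dualMap_apply, LinearMap.dualMap_apply]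

/-- **Equivariance of the derivation action on tensor spaces**: for `e : V ≃ W` and
`T e = e^{⊗a} ⊗ (e⁻ᵀ)^{⊗b} : T^{a,b} V ≃ T^{a,b} W`, `T e (X · t) = (e X e⁻¹) · (T e t)`
(the differential of `T (e g e⁻¹) = T e ∘ T g ∘ (T e)⁻¹`). [folklore] -/
theorem tensorSpaceCongr_tensorSpaceDeriv (e : V ≃ₗ[ℚ] W) (a b : ℕ) (X : Module.End ℚ V)
    (t : hodgeTensorSpace V a b) :
    TensorProduct.congr (PiTensorProduct.congr fun _ : Fin a ↦ e)
        (PiTensorProduct.congr fun _ : Fin b ↦ e.symm.dualMap) (tensorSpaceDeriv V a b X t) =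
      tensorSpaceDeriv W a b (e.conj X)
        (TensorProduct.congr (PiTensorProduct.congr fun _ : Fin a ↦ e)
          (PiTensorProduct.congr fun _ : Fin b ↦ e.symm.dualMap) t) := by
  induction t using TensorProduct.induction_on with
  | zero => simp
  | add x y hx hy => simp only [map_add, hx, hy]
  | tmul x ξ =>
    simp only [tensorSpaceDeriv_tmul, map_sub, TensorProduct.congr_tmul]
    change (PiTensorProduct.map fun _ ↦ (e : V →ₗ[ℚ] W)) (tensorPowerDeriv V a X x) ⊗ₜ[ℚ]
        (PiTensorProduct.map fun _ ↦ (e.symm.dualMap : Module.Dual ℚ V →ₗ[ℚ] Module.Dual ℚ W)) ξ -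
      (PiTensorProduct.map fun _ ↦ (e : V →ₗ[ℚ] W)) x ⊗ₜ[ℚ]
        (PiTensorProduct.map fun _ ↦ (e.symm.dualMap : Module.Dual ℚ V →ₗ[ℚ] Module.Dual ℚ W))
          (tensorPowerDeriv (Module.Dual ℚ V) b X.dualMap ξ) =
      tensorPowerDeriv W a (e.conj X) ((PiTensorProduct.map fun _ ↦ (e : V →ₗ[ℚ] W)) x) ⊗ₜ[ℚ]
        (PiTensorProduct.map fun _ ↦ (e.symm.dualMap : Module.Dual ℚ V →ₗ[ℚ] Module.Dual ℚ W)) ξ -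
      (PiTensorProduct.map fun _ ↦ (e : V →ₗ[ℚ] W)) x ⊗ₜ[ℚ]
        tensorPowerDeriv (Module.Dual ℚ W) b (e.conj X).dualMap
          ((PiTensorProduct.map fun _ ↦
            (e.symm.dualMap : Module.Dual ℚ V →ₗ[ℚ] Module.Dual ℚ W)) ξ)
    rw [map_tensorPowerDeriv e a X x, map_tensorPowerDeriv e.symm.dualMap b X.dualMap ξ,
      conj_symm_dualMap_dualMap]

namespace HodgeStructure

variable {n : ℤ} [HodgeTensorFacts.{u, u}] [Module.Finite ℚ V] [Module.Finite ℚ W]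

/-! ### The Mumford–Tate Lie algebra and rank of a transported Hodge structure -/

/-- **The Mumford–Tate Lie algebra of a transported Hodge structure**:
`𝔪𝔱(e^* H) = e⁻¹ 𝔪𝔱(H) e`, i.e. the preimage of `𝔪𝔱(H)` under conjugation `X ↦ e X e⁻¹`
(the Hodge tensors of `e^* H` are the `(T e)⁻¹`-images of those of `H`, `tensorSpace_comapEquiv`
and `comapEquiv_hodgeClasses`, and the derivation action is equivariant,
`tensorSpaceCongr_tensorSpaceDeriv`). [folklore] -/
theorem mumfordTateLieAlgebra_comapEquiv (H : HodgeStructure W n) (e : V ≃ₗ[ℚ] W) :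
    (H.comapEquiv e).mumfordTateLieAlgebra =
      H.mumfordTateLieAlgebra.comap (e.conj : Module.End ℚ V →ₗ[ℚ] Module.End ℚ W) := by
  ext X
  simp only [Submodule.mem_comap, mem_mumfordTateLieAlgebra_iff, tensorSpace_comapEquiv,
    comapEquiv_hodgeClasses]
  refine forall₃_congr fun a b _ ↦ ⟨fun h t ht ↦ ?_, fun h t ht ↦ ?_⟩
  · -- `t = T e t'` with `t'` a Hodge tensor of `e^* H`
    set T := TensorProduct.congr (PiTensorProduct.congr fun _ : Fin a ↦ e)
      (PiTensorProduct.congr fun _ : Fin b ↦ e.symm.dualMap)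
    have ht' : T (T.symm t) ∈ (H.tensorSpace a b).hodgeClasses 0 := by rwa [T.apply_symm_apply]
    have h1 := h (T.symm t) ht'
    have h2 := tensorSpaceCongr_tensorSpaceDeriv e a b X (T.symm t)
    rw [h1, map_zero, T.apply_symm_apply] at h2
    exact h2.symm
  · have h2 := tensorSpaceCongr_tensorSpaceDeriv e a b X t
    have h1 : tensorSpaceDeriv W a b (e.conj X)
        (TensorProduct.congr (PiTensorProduct.congr fun _ : Fin a ↦ e)
          (PiTensorProduct.congr fun _ : Fin b ↦ e.symm.dualMap) t) = 0 := h _ ht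
    rw [h1] at h2
    exact (TensorProduct.congr (PiTensorProduct.congr fun _ : Fin a ↦ e)
      (PiTensorProduct.congr fun _ : Fin b ↦ e.symm.dualMap)).injective
        (h2.trans (map_zero _).symm)

/-- **The Mumford–Tate rank is an invariant of the isomorphism class of a Hodge structure**:
`dim MT(e^* H) = dim MT(H)` for every `ℚ`-linear equivalence `e : V ≃ W`
(`mumfordTateLieAlgebra_comapEquiv`: the two Lie algebras are conjugate). In particular the
Hodge-genericity notions `VHSData.IsHodgeGenericIn` / `mtRankAt` of a geometric VHS datum depend only
on the Hodge structures of the fibres up to isomorphism (`GeometricVHSData.hodge_eq_comapEquiv`).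
[cite: BaldiKlinglerUllmo2024, §3.2] -/
theorem mtRank_comapEquiv (H : HodgeStructure W n) (e : V ≃ₗ[ℚ] W) :
    (H.comapEquiv e).mtRank = H.mtRank := by
  rw [mtRank, mtRank, mumfordTateLieAlgebra_comapEquiv, Submodule.comap_equiv_eq_map_symm]
  exact LinearEquiv.finrank_map_eq _ _

end HodgeStructure

/-! ### Hodge-genericity of a geometric VHS datum is intrinsic -/

namespace GeometricVHSData

open CategoryTheory

variable {B : BettiHodgeData ℂ} {𝒳 S : SchemeOver ℂ} {f : 𝒳 ⟶ S} {n i : ℕ}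

/-- The rational cohomology `Hⁱ(𝒳_s)` (in `B.W`) of a fibre of a geometric VHS datum with
finite-dimensional fibres is finite dimensional (through `fiberIso s`). [folklore] -/
theorem finite_W_fiberOver (D : GeometricVHSData B f n i)
    [∀ s : ComplexPoints S, Module.Finite ℚ (D.V.fiber s)] (s : ComplexPoints S) :
    Module.Finite ℚ (B.W.obj (fiberOver f s) i) :=
  Module.Finite.equiv (D.fiberIso s)

variable [HodgeTensorFacts.{0, 0}]

/-- **The Mumford–Tate rank of a geometric VHS datum at `s` is that of the Hodge structure
`B.hodge` of the fibre `𝒳_s`** (`hodge_eq_comapEquiv` and `HodgeStructure.mtRank_comapEquiv`): it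
does not depend on the datum `D`, only on the Hodge structure of `Hⁱ(𝒳_s)`.
[cite: BaldiKlinglerUllmo2024, §3.2] -/
theorem mtRankAt_eq_mtRank_hodge (D : GeometricVHSData B f n i)
    [∀ s : ComplexPoints S, Module.Finite ℚ (D.V.fiber s)] (s : ComplexPoints S) :
    D.mtRankAt s = (haveI := D.finite_W_fiberOver s;
      (B.hodge (D.isSmoothProjective_fiberOver s) i).mtRank) := by
  haveI := D.finite_W_fiberOver s
  rw [VHSData.mtRankAt, D.hodge_eq_comapEquiv s, HodgeStructure.mtRank_comapEquiv]

/-- **Hodge-genericity is intrinsic**: `s` is Hodge-generic in `Y` for `D` iff `s ∈ Y` and the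
Mumford–Tate rank of the Hodge structure `B.hodge` on `Hⁱ(𝒳_y)` is maximal at `y = s` among
`y ∈ Y` — a condition on the Hodge structures of the fibres alone. [cite: BaldiKlinglerUllmo2024, §3.2] -/
theorem isHodgeGenericIn_iff (D : GeometricVHSData B f n i)
    [∀ s : ComplexPoints S, Module.Finite ℚ (D.V.fiber s)] (Y : Set (ComplexPoints S))
    (s : ComplexPoints S) :
    D.IsHodgeGenericIn Y s ↔ s ∈ Y ∧ ∀ y ∈ Y,
      (haveI := D.finite_W_fiberOver y;
        (B.hodge (D.isSmoothProjective_fiberOver y) i).mtRank) ≤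
        (haveI := D.finite_W_fiberOver s;
          (B.hodge (D.isSmoothProjective_fiberOver s) i).mtRank) := by
  simp only [VHSData.IsHodgeGenericIn, mtRankAt_eq_mtRank_hodge]

/-- **Two geometric VHS data of the same family have the same Hodge-generic points.**
[cite: BaldiKlinglerUllmo2024, §3.2] -/
theorem isHodgeGenericIn_iff_of_geometricVHSData (D D' : GeometricVHSData B f n i)
    [∀ s : ComplexPoints S, Module.Finite ℚ (D.V.fiber s)]
    [∀ s : ComplexPoints S, Module.Finite ℚ (D'.V.fiber s)] (Y : Set (ComplexPoints S))
    (s : ComplexPoints S) : D.IsHodgeGenericIn Y s ↔ D'.IsHodgeGenericIn Y s := by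
  rw [D.isHodgeGenericIn_iff, D'.isHodgeGenericIn_iff]

end GeometricVHSData

end Literature.AlgebraicGeometry.Motives

end
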